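import Summits.BirchSwinnertonDyer.BirchSwinnertonDyer.Theorems.PrintCf2RubinValueTwoEllipticUnitsLocalRelation
import Literature.NumberTheory.ComplexMultiplication.EllipticUnits.ThetaValueOneModelLattice
import Literature.NumberTheory.EllipticCurves.DeShalitThetaTExpansionValues
import HarnessLib

/-!
# Piece (α) of the `j = 0` seam, the VALUE identity (hval): «which is precisely `e_n(𝔞)`» (de Shalit II.4.9 (ii), last step)
# — the algebraic theta function of the model at the torsion point `ξ(Ω/c)` IS Kato's `Θ(1; (c)·𝔣, 𝔞)`, in `K̄` and in any reading

Cell `bsd-print-cf2`, width seat `bsd-line-cf2c-w4` g15 (piece (α) of LEAD ruling R-α); `--supports` the print leaf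
stmt-BirchSwinnertonDyer-24720 (helper, Theses-free).  THEOREMS ONLY; no `def`, no named fact, no `sorry`.

The bridge reduction `Literature.NumberTheory.EllipticCurves.relColemanSeries_eq_subst_subst_of_forall_sub_ptOfZ_eq` (this seat,
`DeShalitThetaTExpansionColemanValues`) leaves per level `m` a VALUE IDENTITY (hval) in `M_m = E·K_π^{m+1}`:
`ψK · ∏_{c ∈ S∖0} ((x_R − ψx_c)⁻¹)⁶ = β_m`, where `β_m = ι_v(e_{m+1}(𝔞))` (`RelNormCoherentUnits.ofGlobal`, `coe_val_ofGlobal`) with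
`ι̂(e_{m+1}(𝔞))` pinned by `IsThetaValueOne ι (𝔣v^{m+1}) 𝔞` (the lane's `hx`), and `x_R = ι_v(x(ξ(Ω/ψ(v)^{m+1})))`.  This file proves the
GLOBAL form of that identity and its transport to any reading:

* ★★ `thetaAlg_eq_of_isThetaValueOne` — in `K̄`: for the model lattice `L = Ω·ι(𝔣)`, `La = 𝔞⁻¹L`, representatives `S`, a ring `R`
  read in `K̄` by `j` with `ι̂(jK) = (Δ(L)/Δ(La))·Δ(L)^{#S−1}`, `ι̂(j x_c) = ℘_L(c) − b` (g13's theta datum, any shift `b`), an element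
  `ξx ∈ K̄` with `ι̂ ξx = ℘_L(Ω/ι c) − b` (the `x`-coordinate of the `(c)·𝔣`-torsion point `ξ(Ω/c)`) and `θ ∈ K̄` with
  `IsThetaValueOne ι ((c)·𝔣) 𝔞 (ι̂ θ)`: **`jK · ∏_{c' ∈ S∖0} ((ξx − j x_{c'})⁻¹)⁶ = θ`** — injectivity of `ι̂`, g13's
  `PeriodPair.deShalitTheta_eq_const_mul_prod_inv_pow` (`Θ = Θ_alg ∘ ξ`), `isThetaValueOne_span_singleton_mul` (homogeneity
  `Θ(Ω/ι c; L, La, S) = Θ(1; (c)𝔣, 𝔞)`) and `isThetaValueOne_unique`;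
* `thetaAlg_eq_of_map_eq` — transport to a reading: for fields `M`, `N`, ring maps `κ : M → N` and `ιv : K̄ → N` and elements of `M`
  read onto the `ιv ∘ j`-images, the identity holds in `M` (injectivity of `κ`); with `M = M_m`, `N = K̄_v`, `κ` the inclusion,
  `ιv = absClosureEmbedding` this is (hval) from `thetaAlg_eq_of_isThetaValueOne` once `x_R` is identified (the (e)-assembler's (he)).

HONEST FRAMING: bookkeeping over accepted theorems; nothing closes a crux; no summit statement is proved; BSD is not proved by any of this.

## References
* [deShalit1987] E. de Shalit, *Iwasawa theory of elliptic curves with complex multiplication* (1987), II §2.3 (10), II §4.2 (6),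
  II §4.9 (23) and Proposition (ii) (proof, p. 63: «which is precisely `e_n(𝔞)`»).
* [Kato2004Asterisque] K. Kato, Astérisque 295 (2004), §15.5 (the normalisation `Θ(1; 𝔤, 𝔞)`).
-/

-- the summit namespace `Summit.BirchSwinnertonDyer.BirchSwinnertonDyer` repeats the problem name by design (D-0017)
set_option linter.dupNamespace false
set_option autoImplicit false

noncomputable section

open scoped Classical
open scoped NumberField
open PeriodPair Literature.NumberTheory.EllipticCurves
open Literature.NumberTheory.ComplexMultiplication.EllipticUnits
open Summit.BirchSwinnertonDyer.BirchSwinnertonDyer.Theorems.PrintCf2.EllipticUnitsLocal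

namespace Summit.BirchSwinnertonDyer.BirchSwinnertonDyer.Theorems.PrintCf2.KatzMeasureJZeroSeam


/-- ★★ **«which is precisely `e_n(𝔞)`», in `K̄`.**  Model lattice `L = Ω·ι(𝔣)` (`Ω ≠ 0`), `La = 𝔞⁻¹L`, representatives `S`; a ring
`R` with a reading `j : R → K̄` such that `ι̂ ∘ j` gives g13's complex theta datum (`K ↦ (Δ(L)/Δ(La))·Δ(L)^{#S−1}`,
`x_c ↦ ℘_L(c) − b`); `ξx ∈ K̄` with `ι̂ ξx = ℘_L(Ω/ι c) − b`, `c ∈ 𝒪_K ∖ 0` with `(c)·𝔣 ≠ 𝒪_K`; and `θ ∈ K̄` with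
`IsThetaValueOne ι ((c)·𝔣) 𝔞 (ι̂ θ)`.  Then **`jK · ∏_{c' ∈ S∖0} ((ξx − j x_{c'})⁻¹)⁶ = θ`**: both sides have `ι̂`-image
`Θ(Ω/ι c; L, La, S) = Θ(1; (c)𝔣, 𝔞)`.  With `c = ψ(v)^{m+1}`, `θ = e_{m+1}(𝔞)`: de Shalit II.4.9 (ii), last sentence.
[cite: deShalit1987, II §2.3 (10), II §4.9 (23) and Proposition (ii) (proof, p. 63)] [cite: Kato2004Asterisque, §15.5] -/
theorem thetaAlg_eq_of_isThetaValueOne {K : Type} [Field K] [NumberField K] (ι : K →+* ℂ) {𝔣 𝔞 : Ideal (𝓞 K)} {L La : PeriodPair} {S : Finset ℂ} {Ω : ℂ}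
    (hL : ∀ z : ℂ, z ∈ L.lattice ↔ ∃ a ∈ 𝔣, z = Ω * ι (a : K)) (hΩ : Ω ≠ 0)
    (hLa : La.lattice = idealInvLattice ι 𝔞 L.lattice) (hS : L.IsLatticeReps La S)
    {c : 𝓞 K} (hc : c ≠ 0) (hc𝔣 : Ideal.span {c} * 𝔣 ≠ ⊤)
    {R : Type*} [CommRing R] (j : R →+* AlgebraicClosure K) (Kc : R) (x : ℂ → R) (b : ℂ)
    (hK : algClosureEmb ι (j Kc) = L.deltaRatio La * (L.g₂ ^ 3 - 27 * L.g₃ ^ 2) ^ (S.card - 1))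
    (hx : ∀ c' ∈ S.erase 0, algClosureEmb ι (j (x c')) = ℘[L] c' - b)
    {ξx : AlgebraicClosure K} (hξ : algClosureEmb ι ξx = ℘[L] (Ω / ι (c : K)) - b)
    {θ : AlgebraicClosure K} (hθ : IsThetaValueOne ι (Ideal.span {c} * 𝔣) 𝔞 (algClosureEmb ι θ)) :
    j Kc * ∏ c' ∈ S.erase 0, ((ξx - j (x c'))⁻¹) ^ 6 = θ := by
  apply (algClosureEmb ι).injective
  rw [map_mul, map_prod, hK,
    isThetaValueOne_unique hc𝔣 hθ (isThetaValueOne_span_singleton_mul ι hL hΩ hLa hS hc),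
    PeriodPair.deShalitTheta_eq_const_mul_prod_inv_pow L La S (Ω / ι (c : K)) b]
  refine congrArg (fun q => L.deltaRatio La * (L.g₂ ^ 3 - 27 * L.g₃ ^ 2) ^ (S.card - 1) * q)
    (Finset.prod_congr rfl fun c' hc' => ?_)
  rw [map_pow, map_inv₀, map_sub, hξ, hx c' hc']

/-- **Transport of the value identity to a reading.**  For fields `M`, `N` and ring maps `κ : M → N`, `ιv : K̄ → N`: if the
elements `KcM, x_R, xM_{c'}, θM ∈ M` read under `κ` onto `ιv(jK), ιv(ξx), ιv(j x_{c'}), ιv(θ)` and the identity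
`jK · ∏ ((ξx − j x_{c'})⁻¹)⁶ = θ` holds in `K̄` (`thetaAlg_eq_of_isThetaValueOne`), then **`KcM · ∏ ((x_R − xM_{c'})⁻¹)⁶ = θM` in `M`**.
With `M = E·K_π^{m+1} ⊆ N = K̄_v`, `κ` the inclusion, `ιv = absClosureEmbedding K K_v`, `θM = β_m` (`coe_val_ofGlobal`): the
hypothesis (hval) of `relColemanSeries_eq_subst_subst_of_forall_sub_ptOfZ_eq`. [cite: deShalit1987, II §4.9 Proposition (ii) (proof, p. 63)] -/
theorem thetaAlg_eq_of_map_eq {K : Type} [Field K] {M N : Type*} [Field M] [Field N] (κ : M →+* N) (ιv : AlgebraicClosure K →+* N)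
    {R : Type*} [CommRing R] (j : R →+* AlgebraicClosure K) {ι' : Type*} (T : Finset ι') (Kc : R) (x : ι' → R)
    {ξx θ : AlgebraicClosure K} (hglob : j Kc * ∏ c' ∈ T, ((ξx - j (x c'))⁻¹) ^ 6 = θ)
    {KcM xR θM : M} {xM : ι' → M} (hKc : κ KcM = ιv (j Kc)) (hxR : κ xR = ιv ξx)
    (hxM : ∀ c' ∈ T, κ (xM c') = ιv (j (x c'))) (hθM : κ θM = ιv θ) :
    KcM * ∏ c' ∈ T, ((xR - xM c')⁻¹) ^ 6 = θM := by
  apply κ.injective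
  rw [map_mul, map_prod, hKc, hθM, ← hglob, map_mul, map_prod]
  refine congrArg (fun q => ιv (j Kc) * q) (Finset.prod_congr rfl fun c' hc' => ?_)
  rw [map_pow, map_inv₀, map_sub, hxR, hxM c' hc', map_pow, map_inv₀, map_sub]

end Summit.BirchSwinnertonDyer.BirchSwinnertonDyer.Theorems.PrintCf2.KatzMeasureJZeroSeam

end
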